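import Mathlib.GroupTheory.Nilpotent
import Mathlib.GroupTheory.QuotientGroup.Basic
import Literature.Topology.FourManifolds.GroupTrisections
import HarnessLib

/-!
# Stub `stub_noHiddenDepth` of line `saturated-torsor-descent` for crux
`CongruenceShadows.NilpotentShadowsStandard` (item stmt-SmoothPoincare4-14594)

**No hidden depth for honest handlebody kernels.**  Let `S` be a group and `Q ◁ S` a normal
subgroup with *free* quotient `S ⧸ Q ≅ F` (here `S = S_g` is a surface group and
`F = F_n = FreeGroup (Fin n)`, `IsFreeOfRank (S ⧸ Q) n`).  Then

  `Q ∩ [S, S] ≤ [Q, S]`,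

i.e. `Q ∩ γ₂ S ≤ [Q, S]` with `γ₂ S = (⊤ : Subgroup S).lowerCentralSeries 1 = ⁅⊤, ⊤⁆`.

Proof (the `δ`-trick; nothing about surfaces is used).  Put `M = [Q, S] ◁ S`, `P = S ⧸ M` and
let `π̄ : P → S ⧸ Q` be the projection.  Since `[Q, S] = M`, every element of `ker π̄ = Q ⧸ M` is
central in `P`.  The quotient `S ⧸ Q` is free, so `π̄` has a section `σ` (lift chosen preimages
of the images of the free generators), and `ρ = σ ∘ e⁻¹ ∘ π̄` satisfies `π̄ ∘ ρ = π̄`.  Hence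
`δ p = p · ρ(p)⁻¹ ∈ ker π̄` is central for every `p`, which makes `δ : P → P` a homomorphism with
commuting values; so `δ` kills `[P, P]`.  For `x ∈ Q ∩ [S, S]` with image `p ∈ P`:
`π̄ p = 1`, so `ρ p = 1` and `δ p = p`; and `p ∈ [P, P]`, so `δ p = 1`.  Thus `p = 1`,
i.e. `x ∈ M = [Q, S]`.

Mathlib only; no new definitions, no named facts.
-/

-- the prescribed namespace `Summit.<P>.<Sub>.…` duplicates `SmoothPoincare4` (P = Sub)
set_option linter.dupNamespace false

open Literature.Topology.FourManifolds Subgroup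
open scoped commutatorElement

namespace Summit.SmoothPoincare4.SmoothPoincare4.Theorems.NilpotentShadowsStandard.SaturatedTorsorDescent

/-- **No hidden depth, group-theoretic core** (the `δ`-trick).  If `Q ◁ S` has a free quotient
`S ⧸ Q ≅ FreeGroup ι`, then `Q ⊓ ⁅S, S⁆ ≤ ⁅Q, S⁆`: the central extension
`Q ⧸ ⁅Q, S⁆ ↪ S ⧸ ⁅Q, S⁆ ↠ S ⧸ Q` splits, so the commutator subgroup of `S ⧸ ⁅Q, S⁆` meets the
central kernel trivially. [folklore] -/
theorem inf_commutator_le_commutator_of_free {S : Type*} [Group S] {ι : Type*}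
    (Q : Subgroup S) [Q.Normal] (e : FreeGroup ι ≃* S ⧸ Q) :
    Q ⊓ ⁅(⊤ : Subgroup S), (⊤ : Subgroup S)⁆ ≤ ⁅Q, (⊤ : Subgroup S)⁆ := by
  -- `M = [Q, S] ≤ Q`, `P = S ⧸ M`, `π̄ : P → S ⧸ Q`
  set M : Subgroup S := ⁅Q, (⊤ : Subgroup S)⁆
  have hMQ : M ≤ Q.comap (MonoidHom.id S) := fun x hx => commutator_le_left Q ⊤ hx
  set πb : S ⧸ M →* S ⧸ Q := QuotientGroup.map M Q (MonoidHom.id S) hMQ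
  have hπb_mk : ∀ s : S, πb (s : S ⧸ M) = (s : S ⧸ Q) := fun s => rfl
  have hsurj : Function.Surjective πb := by
    intro y
    obtain ⟨s, rfl⟩ := QuotientGroup.mk_surjective y
    exact ⟨s, hπb_mk s⟩
  -- the elements of `ker π̄ = Q ⧸ M` are central in `P`
  have hcentral : ∀ p : S ⧸ M, πb p = 1 → ∀ p' : S ⧸ M, p * p' = p' * p := by
    intro p hp p'
    obtain ⟨s, rfl⟩ := QuotientGroup.mk_surjective p
    obtain ⟨t, rfl⟩ := QuotientGroup.mk_surjective p'
    rw [hπb_mk, QuotientGroup.eq_one_iff] at hp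
    rw [← commutatorElement_eq_one_iff_mul_comm]
    change ((⁅s, t⁆ : S) : S ⧸ M) = 1
    rw [QuotientGroup.eq_one_iff]
    exact commutator_mem_commutator hp (mem_top t)
  -- a section `σ` of `π̄` over the free group (free groups are projective) ...
  obtain ⟨σ, hσ⟩ : ∃ σ : FreeGroup ι →* S ⧸ M, ∀ w, πb (σ w) = e w := by
    refine ⟨FreeGroup.lift fun i => Classical.choose (hsurj (e (FreeGroup.of i))), fun w => ?_⟩
    have h : πb.comp (FreeGroup.lift fun i => Classical.choose (hsurj (e (FreeGroup.of i)))) =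
        e.toMonoidHom :=
      FreeGroup.ext_hom _ _ fun i => by
        rw [MonoidHom.comp_apply, FreeGroup.lift_apply_of]
        exact Classical.choose_spec (hsurj (e (FreeGroup.of i)))
    exact DFunLike.congr_fun h w
  -- ... and the retraction `ρ = σ ∘ e⁻¹ ∘ π̄` of `P` onto `σ(F)` over `S ⧸ Q`
  obtain ⟨ρ, hρ, hρ1⟩ : ∃ ρ : S ⧸ M →* S ⧸ M, (∀ p, πb (ρ p) = πb p) ∧ ∀ p, πb p = 1 → ρ p = 1 := by
    refine ⟨σ.comp (e.symm.toMonoidHom.comp πb), fun p => ?_, fun p hp => ?_⟩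
    · show πb (σ (e.symm (πb p))) = πb p
      rw [hσ, MulEquiv.apply_symm_apply]
    · show σ (e.symm (πb p)) = 1
      rw [hp, map_one, map_one]
  -- `δ p = p · ρ(p)⁻¹ ∈ ker π̄` is central, so `δ` is a homomorphism `P → P`
  have hδker : ∀ p, πb (p * (ρ p)⁻¹) = 1 := fun p => by
    rw [map_mul, map_inv, hρ, mul_inv_cancel]
  obtain ⟨δ, hδ⟩ : ∃ δ : S ⧸ M →* S ⧸ M, ∀ p, δ p = p * (ρ p)⁻¹ := by
    refine ⟨MonoidHom.mk' (fun p => p * (ρ p)⁻¹) fun p q => ?_, fun p => rfl⟩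
    have hc := hcentral _ (hδker q) (ρ p)⁻¹
    show p * q * (ρ (p * q))⁻¹ = p * (ρ p)⁻¹ * (q * (ρ q)⁻¹)
    rw [map_mul, mul_inv_rev, mul_assoc p (ρ p)⁻¹, ← hc]
    simp only [mul_assoc]
  -- `δ` has commuting (central) values, so it kills `[P, P]`
  have hδcomm : ⁅(⊤ : Subgroup (S ⧸ M)), (⊤ : Subgroup (S ⧸ M))⁆ ≤ δ.ker := by
    rw [commutator_le]
    intro p _ q _
    rw [MonoidHom.mem_ker, map_commutatorElement, commutatorElement_eq_one_iff_mul_comm, hδ, hδ]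
    exact hcentral _ (hδker p) _
  -- conclusion: for `x ∈ Q ∩ [S, S]` the image `p ∈ P` has `δ p = p` and `δ p = 1`
  rintro x ⟨hxQ, hxC⟩
  have hx1 : πb (x : S ⧸ M) = 1 := by
    rw [hπb_mk, QuotientGroup.eq_one_iff]
    exact hxQ
  have hx2 : (x : S ⧸ M) ∈ ⁅(⊤ : Subgroup (S ⧸ M)), (⊤ : Subgroup (S ⧸ M))⁆ := by
    have h := mem_map_of_mem (QuotientGroup.mk' M) hxC
    rw [map_commutator] at h
    exact commutator_mono le_top le_top h
  have hx3 : δ (x : S ⧸ M) = 1 := hδcomm hx2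
  rw [hδ, hρ1 _ hx1, inv_one, mul_one, QuotientGroup.eq_one_iff] at hx3
  exact hx3

/-- **No hidden depth** (registered stub `stub_noHiddenDepth` = `NoHiddenDepth`): for a normal
subgroup `Q` of the surface group `S_g` with free quotient `S_g ⧸ Q ≅ F_n`,
`Q ∩ γ₂ S_g ≤ [Q, S_g]`. [folklore] -/
theorem stub_noHiddenDepth : ∀ (g n : ℕ) (Q : Subgroup (Literature.Topology.FourManifolds.SurfaceGroup g)) [Q.Normal], Literature.Topology.FourManifolds.IsFreeOfRank (Literature.Topology.FourManifolds.SurfaceGroup g ⧸ Q) n → Q ⊓ (⊤ : Subgroup (Literature.Topology.FourManifolds.SurfaceGroup g)).lowerCentralSeries 1 ≤ ⁅Q, (⊤ : Subgroup (Literature.Topology.FourManifolds.SurfaceGroup g))⁆ := by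
  intro g n Q _ hfree
  obtain ⟨e⟩ := hfree
  exact inf_commutator_le_commutator_of_free Q e

end Summit.SmoothPoincare4.SmoothPoincare4.Theorems.NilpotentShadowsStandard.SaturatedTorsorDescent
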